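import Literature.Analysis.Hypoelliptic.Multipliers
import Literature.Analysis.Hypoelliptic.KernelComposition
import Mathlib.Analysis.SpecialFunctions.Sqrt
import HarnessLib

/-!
# The regularising multipliers `e^{-δ⟨ξ⟩}` with `δ`-uniform symbol estimates

Analysis/Hypoelliptic support file serving the discharge of
`Literature.Analysis.Distribution.Hormander1967_thm11` by Kohn's method (M. Taylor,
*Pseudodifferential Operators* (1981), Ch. XV §1, the smoothing families of (1.22)–(1.27)).

The bootstrap from the a priori estimate to the regularity of a distribution needs a family
of smoothing multipliers whose commutator gains are UNIFORM in the parameter. We use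
`m_δ(ξ) = e^{-δ⟨ξ⟩}`, `0 < δ ≤ 1`:

* the profile `ρ_δ(t) = e^{-δ√t}` satisfies `ShapeBounds` of order `0` with the
  `δ`-INDEPENDENT constants `B₁ = 1/2`, `B₂ = 5/4` (`shapeBounds_regProfile`), hence
  `m_δ = radial ρ_δ` has first differences of order `-1` and second differences of order `-2`
  with `δ`-independent constants (`mulDiff_reg`, `mulDiff2_reg`);
* `0 < m_δ ≤ 1`, `m_δ → 1` as `δ → 0`, and `m_δ F ∈ Nice` for `F` in a single `Ĥ^t`
  (`nice_reg_mul`).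

## References

* M. E. Taylor, *Pseudodifferential Operators* (1981), Ch. XV §1, (1.22)–(1.27).
-/

noncomputable section

open MeasureTheory Set Filter Function Real
open scoped ENNReal NNReal Topology ComplexConjugate InnerProductSpace

namespace Literature.Analysis.Hypoelliptic

/-! ### The profile `e^{-δ√t}` -/

/-- The profile `ρ_δ(t) = e^{-δ√t}`. [folklore] -/
def regProfile (δ : ℝ) (t : ℝ) : ℝ := exp (-δ * sqrt t)

/-- Its derivative `ρ_δ'(t) = -(δ/2) e^{-δ√t} / √t` (for `t > 0`). [folklore] -/
def regProfile' (δ : ℝ) (t : ℝ) : ℝ := -(δ / 2) * exp (-δ * sqrt t) * (sqrt t)⁻¹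

/-- Its second derivative `ρ_δ''(t) = (δ/4) e^{-δ√t} (δ/t + 1/(t√t))` (for `t > 0`). [folklore] -/
def regProfile'' (δ : ℝ) (t : ℝ) : ℝ :=
  (δ / 4) * exp (-δ * sqrt t) * (δ * t⁻¹ + t⁻¹ * (sqrt t)⁻¹)

/-- `x e^{-x} ≤ 1`. [folklore] -/
theorem mul_exp_neg_le_one (x : ℝ) : x * exp (-x) ≤ 1 := by
  have h := add_one_le_exp x
  rw [exp_neg]
  have hx' : 0 < exp x := exp_pos x
  rw [mul_inv_le_iff₀ hx']
  linarith

/-- `x² e^{-x} ≤ 4` for `x ≥ 0`. [folklore] -/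
theorem sq_mul_exp_neg_le {x : ℝ} (hx : 0 ≤ x) : x ^ 2 * exp (-x) ≤ 4 := by
  have hx2 : 0 ≤ x / 2 + 1 := by linarith [hx]
  have h := add_one_le_exp (x / 2)
  have h2 : exp x = exp (x / 2) ^ 2 := by rw [← exp_nat_mul]; ring_nf
  rw [exp_neg, mul_inv_le_iff₀ (exp_pos x), h2]
  nlinarith [h, mul_le_mul h h hx2 (exp_pos _).le]

/-- The derivative of the profile. [folklore] -/
theorem hasDerivAt_regProfile (δ : ℝ) {t : ℝ} (ht : 0 < t) :
    HasDerivAt (regProfile δ) (regProfile' δ t) t := by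
  unfold regProfile regProfile'
  have h1 : HasDerivAt (fun t => -δ * sqrt t) (-δ * (1 / (2 * sqrt t))) t :=
    (hasDerivAt_sqrt ht.ne').const_mul (-δ)
  refine (h1.exp).congr_deriv ?_
  field_simp

/-- The second derivative of the profile. [folklore] -/
theorem hasDerivAt_regProfile' (δ : ℝ) {t : ℝ} (ht : 0 < t) :
    HasDerivAt (regProfile' δ) (regProfile'' δ t) t := by
  unfold regProfile''
  have hs : 0 < sqrt t := sqrt_pos.2 ht
  have h1 : HasDerivAt (fun t => -δ * sqrt t) (-δ * (1 / (2 * sqrt t))) t :=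
    (hasDerivAt_sqrt ht.ne').const_mul (-δ)
  have hE : HasDerivAt (fun t => exp (-δ * sqrt t)) (exp (-δ * sqrt t) * (-δ * (1 / (2 * sqrt t)))) t :=
    h1.exp
  have hI : HasDerivAt (fun t => (sqrt t)⁻¹) (-(1 / (2 * sqrt t)) / (sqrt t) ^ 2) t :=
    (hasDerivAt_sqrt ht.ne').inv hs.ne'
  have hfun : regProfile' δ = fun t => -(δ / 2) * (exp (-δ * sqrt t) * (sqrt t)⁻¹) := by
    ext; unfold regProfile'; ring
  rw [hfun]
  refine ((hE.mul hI).const_mul (-(δ / 2))).congr_deriv ?_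
  have hs2 : sqrt t ^ 2 = t := sq_sqrt ht.le
  field_simp
  rw [hs2]
  ring

/-- **Uniform shape bounds**: `ρ_δ` has shape bounds of order `0` with constants `1/2`, `5/4`
independent of `δ ≥ 0`. [folklore] -/
theorem shapeBounds_regProfile {δ : ℝ} (hδ : 0 ≤ δ) :
    ShapeBounds (regProfile δ) (regProfile' δ) (regProfile'' δ) 0 (1 / 2) (5 / 4) where
  hasDeriv t ht := hasDerivAt_regProfile δ (by linarith)
  hasDeriv2 t ht := hasDerivAt_regProfile' δ (by linarith)
  nonneg₁ := by norm_num
  nonneg₂ := by norm_num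
  bound₁ t ht := by
    have ht0 : 0 < t := by linarith
    have hs : 0 < sqrt t := sqrt_pos.2 ht0
    have hx : 0 ≤ δ * sqrt t := mul_nonneg hδ hs.le
    have hkey := mul_exp_neg_le_one (δ * sqrt t)
    have hti : t⁻¹ = (sqrt t)⁻¹ * (sqrt t)⁻¹ := by rw [← mul_inv, mul_self_sqrt ht0.le]
    rw [show ((0 : ℝ) - 2) / 2 = -1 by norm_num, rpow_neg_one, hti,
      show regProfile' δ t = -((δ / 2) * exp (-δ * sqrt t) * (sqrt t)⁻¹) by
        unfold regProfile'; ring, abs_neg, abs_of_nonneg (by positivity)]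
    rw [neg_mul] 
    calc δ / 2 * exp (-(δ * sqrt t)) * (sqrt t)⁻¹
        = (1 / 2 * ((sqrt t)⁻¹ * (sqrt t)⁻¹)) * (δ * sqrt t * exp (-(δ * sqrt t))) := by
          field_simp
      _ ≤ 1 / 2 * ((sqrt t)⁻¹ * (sqrt t)⁻¹) := mul_le_of_le_one_right (by positivity) hkey
  bound₂ t ht := by
    have ht0 : 0 < t := by linarith
    have hs : 0 < sqrt t := sqrt_pos.2 ht0
    have hx : 0 ≤ δ * sqrt t := mul_nonneg hδ hs.le
    have h1 := mul_exp_neg_le_one (δ * sqrt t)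
    have h2 := sq_mul_exp_neg_le hx
    have hti : t⁻¹ = (sqrt t)⁻¹ * (sqrt t)⁻¹ := by rw [← mul_inv, mul_self_sqrt ht0.le]
    have ht2 : (t ^ 2)⁻¹ = ((sqrt t)⁻¹) ^ 4 := by rw [← inv_pow, hti]; ring
    rw [show ((0 : ℝ) - 4) / 2 = -2 by norm_num, rpow_neg ht0.le, rpow_two, ht2]
    unfold regProfile''
    rw [abs_of_nonneg (by positivity), neg_mul, hti]
    calc δ / 4 * exp (-(δ * sqrt t)) * (δ * ((sqrt t)⁻¹ * (sqrt t)⁻¹) +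
          (sqrt t)⁻¹ * (sqrt t)⁻¹ * (sqrt t)⁻¹)
        = (1 / 4 * (sqrt t)⁻¹ ^ 4) * ((δ * sqrt t) ^ 2 * exp (-(δ * sqrt t)) +
            δ * sqrt t * exp (-(δ * sqrt t))) := by field_simp
      _ ≤ (1 / 4 * (sqrt t)⁻¹ ^ 4) * (4 + 1) :=
          mul_le_mul_of_nonneg_left (add_le_add h2 h1) (by positivity)
      _ = 5 / 4 * (sqrt t)⁻¹ ^ 4 := by ring

/-- The profile is measurable. [folklore] -/
theorem measurable_regProfile (δ : ℝ) : Measurable (regProfile δ) := by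
  unfold regProfile; fun_prop

/-! ### The multipliers `m_δ = e^{-δ⟨ξ⟩}` -/

variable {V : Type*} [NormedAddCommGroup V] [InnerProductSpace ℝ V] [MeasurableSpace V]
  [BorelSpace V]

/-- **The regularising multiplier** `m_δ(ξ) = e^{-δ⟨ξ⟩}`. [folklore] -/
def reg (δ : ℝ) (ξ : V) : ℂ := radial (regProfile δ) ξ

omit [InnerProductSpace ℝ V] [MeasurableSpace V] [BorelSpace V] in
/-- `m_δ(ξ) = e^{-δ⟨ξ⟩}` with `⟨ξ⟩ = bw 1 ξ`. [folklore] -/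
theorem reg_apply (δ : ℝ) (ξ : V) : reg δ ξ = (exp (-δ * bw 1 ξ) : ℂ) := by
  unfold reg
  rw [radial_apply, regProfile, bw_one]

omit [InnerProductSpace ℝ V] [MeasurableSpace V] [BorelSpace V] in
/-- `m_δ` is real and positive. [folklore] -/
theorem reg_pos (δ : ℝ) (ξ : V) : 0 < (reg δ ξ).re := by
  rw [reg_apply, Complex.ofReal_re]; exact exp_pos _

omit [InnerProductSpace ℝ V] [MeasurableSpace V] [BorelSpace V] in
/-- `‖m_δ(ξ)‖ = e^{-δ⟨ξ⟩}`. [folklore] -/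
theorem norm_reg (δ : ℝ) (ξ : V) : ‖reg δ ξ‖ = exp (-δ * bw 1 ξ) := by
  rw [reg_apply, Complex.norm_real, Real.norm_eq_abs, abs_of_pos (exp_pos _)]

omit [InnerProductSpace ℝ V] [MeasurableSpace V] [BorelSpace V] in
/-- `‖m_δ‖ ≤ 1` for `δ ≥ 0`. [folklore] -/
theorem norm_reg_le_one {δ : ℝ} (hδ : 0 ≤ δ) (ξ : V) : ‖reg δ ξ‖ ≤ 1 := by
  rw [norm_reg, exp_le_one_iff]
  have := bw_nonneg 1 ξ
  nlinarith

omit [InnerProductSpace ℝ V] [MeasurableSpace V] [BorelSpace V] in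
/-- `m_0 = 1`. [folklore] -/
theorem reg_zero (ξ : V) : reg 0 ξ = 1 := by simp [reg_apply]

omit [InnerProductSpace ℝ V] [MeasurableSpace V] [BorelSpace V] in
/-- **`m_δ(ξ) → 1` as `δ → 0`.** [folklore] -/
theorem tendsto_reg (ξ : V) : Tendsto (fun δ => reg δ ξ) (𝓝 0) (𝓝 1) := by
  have h : Continuous fun δ : ℝ => (reg δ ξ : ℂ) := by
    simp only [reg_apply]; fun_prop
  have := h.tendsto 0
  rwa [reg_zero] at this

omit [InnerProductSpace ℝ V] in
/-- `m_δ` as a bounded multiplier of order `0`, constant `1`. [folklore] -/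
theorem mulBound_reg {δ : ℝ} (hδ : 0 ≤ δ) : MulBound (reg (V := V) δ) 0 1 where
  measurable := Complex.measurable_ofReal.comp ((measurable_regProfile δ).comp (by fun_prop))
  nonneg := zero_le_one
  bound ξ := by rw [bw_zero, mul_one]; exact norm_reg_le_one hδ ξ

/-- **First differences of `m_δ`, uniformly in `δ ≥ 0`**: order `-1`, constants `√2`,
`M = 2`. [folklore] -/
theorem mulDiff_reg {δ : ℝ} (hδ : 0 ≤ δ) :
    MulDiff (reg (V := V) δ) (-1) (2 * (1 / 2) * 2 ^ (|(0 : ℝ) - 1| / 2)) (|(0 : ℝ) - 1| + 1) := by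
  have h := (shapeBounds_regProfile hδ).mulDiff_radial (V := V) (measurable_regProfile δ)
  rw [show (0 : ℝ) - 1 = -1 by norm_num] at h ⊢
  exact h

/-- **Second differences of `m_δ`, uniformly in `δ ≥ 0`**: order `-2`. [folklore] -/
theorem mulDiff2_reg {δ : ℝ} (hδ : 0 ≤ δ) :
    MulDiff2 (reg (V := V) δ) (-2) ((4 * (5 / 4) + 2 * (1 / 2)) * 2 ^ |(0 : ℝ) - 2|)
      (|(0 : ℝ) - 2| + 1) := by
  have h := (shapeBounds_regProfile hδ).mulDiff2_radial (V := V) (measurable_regProfile δ)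
  rw [show (0 : ℝ) - 2 = -2 by norm_num] at h ⊢
  exact h

/-! ### `m_δ F ∈ Nice` for `F` in a single `Ĥ^t` -/

omit [InnerProductSpace ℝ V] [MeasurableSpace V] [BorelSpace V] in
/-- `⟨ξ⟩^k e^{-δ⟨ξ⟩} ≤ (k/δ)^k`-type bound: for `δ > 0` and `k ≥ 0`,
`⟨ξ⟩^k e^{-δ⟨ξ⟩} ≤ (⌈k⌉₊)! δ^{-⌈k⌉₊}`. [folklore] -/
theorem bw_mul_exp_neg_le {δ : ℝ} (hδ : 0 < δ) (k : ℝ) (ξ : V) :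
    bw k ξ * exp (-δ * bw 1 ξ) ≤ (Nat.factorial ⌈k⌉₊) * δ⁻¹ ^ ⌈k⌉₊ := by
  set n := ⌈k⌉₊ with hn
  have hx : 0 ≤ δ * bw 1 ξ := mul_nonneg hδ.le (bw_nonneg 1 ξ)
  -- `(δ⟨ξ⟩)^n / n! ≤ e^{δ⟨ξ⟩}`
  have h1 : (δ * bw 1 ξ) ^ n / (Nat.factorial n) ≤ exp (δ * bw 1 ξ) :=
    pow_div_factorial_le_exp _ hx n
  have hb1 : 1 ≤ bw 1 ξ := one_le_bw_one ξ
  -- `⟨ξ⟩^k ≤ ⟨ξ⟩^n`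
  have h2 : bw k ξ ≤ bw 1 ξ ^ n := by
    rw [show bw 1 ξ ^ n = bw (n : ℝ) ξ by
      rw [bw, bw, ← Real.rpow_natCast, ← Real.rpow_mul (one_add_norm_sq_pos ξ).le]; ring_nf]
    exact bw_mono (Nat.le_ceil k) ξ
  have hfac : (0 : ℝ) < Nat.factorial n := by exact_mod_cast Nat.factorial_pos n
  have h3 : bw 1 ξ ^ n ≤ (Nat.factorial n) * δ⁻¹ ^ n * exp (δ * bw 1 ξ) := by
    rw [div_le_iff₀ hfac, mul_pow] at h1
    have hδn : 0 < δ ^ n := pow_pos hδ n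
    calc bw 1 ξ ^ n = (δ ^ n)⁻¹ * (δ ^ n * bw 1 ξ ^ n) := by field_simp
      _ ≤ (δ ^ n)⁻¹ * (exp (δ * bw 1 ξ) * Nat.factorial n) :=
          mul_le_mul_of_nonneg_left h1 (by positivity)
      _ = (Nat.factorial n) * δ⁻¹ ^ n * exp (δ * bw 1 ξ) := by rw [inv_pow]; ring
  calc bw k ξ * exp (-δ * bw 1 ξ) ≤ bw 1 ξ ^ n * exp (-δ * bw 1 ξ) :=
        mul_le_mul_of_nonneg_right h2 (exp_pos _).le
    _ ≤ (Nat.factorial n) * δ⁻¹ ^ n * exp (δ * bw 1 ξ) * exp (-δ * bw 1 ξ) :=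
        mul_le_mul_of_nonneg_right h3 (exp_pos _).le
    _ = (Nat.factorial n) * δ⁻¹ ^ n := by rw [mul_assoc, ← exp_add]; simp

omit [InnerProductSpace ℝ V] [MeasurableSpace V] [BorelSpace V] in
/-- `‖m_δ(ξ)‖ ≤ C_k ⟨ξ⟩^{-k}` for `δ > 0`. [folklore] -/
theorem norm_reg_le_bw_neg {δ : ℝ} (hδ : 0 < δ) (k : ℝ) (ξ : V) :
    ‖reg δ ξ‖ ≤ ((Nat.factorial ⌈k⌉₊) * δ⁻¹ ^ ⌈k⌉₊) * bw (-k) ξ := by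
  rw [norm_reg, bw_neg, ← div_eq_mul_inv, le_div_iff₀ (bw_pos k ξ), mul_comm]
  exact bw_mul_exp_neg_le hδ k ξ

variable [FiniteDimensional ℝ V]

/-- **`m_δ F ∈ Nice` for `F ∈ Ĥ^t`** (`δ > 0`): the regularised function has all weighted norms
finite. [folklore] -/
theorem nice_reg_mul {δ : ℝ} (hδ : 0 < δ) {t : ℝ} {F : V → ℂ} (hF : InH t F) :
    Nice (fun ξ => reg δ ξ * F ξ) := by
  refine ⟨(mulBound_reg hδ.le).measurable.aestronglyMeasurable.mul hF.1, fun t' => ?_⟩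
  rcases le_or_gt t' t with h | h
  · -- `‖m_δ‖ ≤ 1 ≤ ⟨ξ⟩^{t - t'}`
    have hb : ∀ ξ : V, ‖reg δ ξ‖ ≤ 1 * bw (t - t') ξ := fun ξ => by
      rw [one_mul]; exact (norm_reg_le_one hδ.le ξ).trans (one_le_bw (by linarith) ξ)
    have := wnorm_mul_le zero_le_one hb t F
    rw [show t - (t - t') = t' by ring] at this
    exact this.trans_lt (ENNReal.mul_lt_top ENNReal.ofReal_lt_top hF.2)
  · have hk : 0 ≤ t' - t := by linarith
    have hb : ∀ ξ : V, ‖reg δ ξ‖ ≤ ((Nat.factorial ⌈t' - t⌉₊) * δ⁻¹ ^ ⌈t' - t⌉₊) * bw (-(t' - t)) ξ :=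
      fun ξ => norm_reg_le_bw_neg hδ (t' - t) ξ
    have := wnorm_mul_le (by positivity) hb t F
    rw [show t - -(t' - t) = t' by ring] at this
    exact this.trans_lt (ENNReal.mul_lt_top ENNReal.ofReal_lt_top hF.2)

/-- `m_δ F ∈ Ĥ^t` with `wnorm t (m_δ F) ≤ wnorm t F` (`δ ≥ 0`). [folklore] -/
theorem wnorm_reg_mul_le {δ : ℝ} (hδ : 0 ≤ δ) (t : ℝ) (F : V → ℂ) :
    wnorm t (fun ξ => reg δ ξ * F ξ) ≤ wnorm t F := by
  have hb : ∀ ξ : V, ‖reg δ ξ‖ ≤ 1 * bw 0 ξ := fun ξ => by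
    rw [one_mul, bw_zero]; exact norm_reg_le_one hδ ξ
  have := wnorm_mul_le zero_le_one hb t F
  rw [sub_zero, ENNReal.ofReal_one, one_mul] at this
  exact this

end Literature.Analysis.Hypoelliptic
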